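import Summits.QuantumFields.BalabanUV.Beta.D1BFx.SortedPack
import Summits.QuantumFields.BalabanUV.Beta.D1BFx.TorusTraceTadpole

/-!
# `BalabanUV.Beta.D1BFx.SortedTraces` — road «BF-x» for binder row D1, slot (K), X₃(ii) ROUTE T, Tier A brick **TA5 «SORTED ONE-LOOP
# FUNCTIONALS»**: the currency glue between TA1 (sorted kernels over the COARSE base, `sortK`) and TA3 (one-sorted `toF`∕`arr` data):
# TA1's sorted pack AS an `ExpKernelCalculus` kernel, transport of `Decays`∕`BiLoc`∕block covariance∕arrays through sorting, invariance of
# `comp`∕`tr`∕`tadpole`∕`bubble`∕`hessKer` under sorting, `hessT` under re-indexing, and THE TB5 SOCKET — TA3b's hess limit stated for the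
# torus objects TB1∕TB2∕TA4 actually produce, landing on the road's FINE-lattice `hessKer`

HONEST DEPENDENCY (cell records, verbatim): «continuum YM on T⁴ ⇐ BetaPertH ∧ nine spine estimates (0/9 proved); BetaPertH ⇐ (D1) ∧ (D4) ∧
CAP+tail; G-an2-4 gates asym, D1 and NE2/3/4.»  HONEST FRAMING (cell contract, verbatim): «discharging `BetaPertH` makes Bałaban's UV stability
UNCONDITIONAL — a real constructive-QFT result; it is NOT the continuum limit and NOT the Clay problem.»  THIS MODULE DISCHARGES NOTHING of (K),
of D1 or of the wall: [folklore] re-indexing and absolutely convergent bookkeeping over the cell's own typed objects — an2's `ExpKernelCalculus`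
(`MKer`, `comp`, `tr`, `tadpole`, `bubble`, `hessKer`, `Decays`, `BiLoc`, `shiftK`) and `TameKernelCalculus` (`Tame`, `Spr`, `Loc`, `slice_tame`),
the D1 swarm's TA1 `SortedReblocking` ∕ `SortedPack` (`finePt`, `blockEquiv`, `reblock`, `sortK`, `sortK_comp`), TA2 `PeriodicArrays` (`arr`, `toF`),
TA3b `TorusTraceTadpole` (`toF_comp`, `tendsto_hessT_hessKer`) and TA4 `MixedVarPackedHess` (`hessT`) — all USED BY NAME.  One [our object] data
definition (`sortM`, a re-reading of `sortK`); no `def … : Prop`, nothing cited, no wall binder instantiated, 0 sorry.  NOT D1, NOT BetaPertH, NOT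
continuum, NOT Clay.

ABSOLUTE RULE (cell charter, verbatim): «No internally-minted statement may enter as a cited fact. Every hypothesis is either kernel-proved in this
package or a verbatim quotation of a PUBLISHED theorem with page reference. The manuscript(s) under audit are NOT citable for their own disputed
steps — they are the thing under adjudication; programme-internal (2001/route/tribunal) claims are never citable.»

WHY (`HOME/b2b-balaban-beta-d1-p2/K-ASSEMBLY-SPEC.md` v1.1 §1, TB5 «ASSEMBLY»).  TB1∕TB2 deliver the torus matrices `M_T`, `N_T` of the model
identity `mixedVar_sliceTransfer_jets` over the COARSE torus `Site D p` in TA1's SORTED currency `periodiseF p (sortK n Pack)` (fibre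
`((ℤ∕n)^D × F) ⊕ F`: fine bonds by in-block position ⊕ coarse bonds); TA4 reads the four `mixedVar`s as `hessT` over `ν_T ⊕ μ_T`, a `reindex` of
that.  TA3b's `tendsto_hessT_hessKer` is stated for `periodiseF σ (toF A)` ∕ `toF (arr σ V)` with ONE-sorted `MKer D F′` data and converges to the
`hessKer` OF THOSE DATA, whereas (K)'s two sides are `hessKer`s of embedded packs `MKer D (F ⊕ F)` on the FINE lattice (`FirstStepPinned`,
`BlockMeanBlindnessLegs`).  This file closes the gap: §1 [our object]
`sortM n K : MKer D ((TorusSite D n × F) ⊕ F)` with `toF (sortM n K) = sortK n K` (`rfl`); §2 [folklore] re-blocking geometry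
`l1 (y − y′) − D·n ≤ l1 (finePt n y z − finePt n y′ z′)`; §3 [folklore] TRANSPORT `decays_sortM` (constant `C·e^{δDn}`, same rate), `biLoc_sortM`
(at the blocks `quo n P`, `quo n Q`, constant `C·e^{2δDn}`), `sortM_imageShift` (block covariance ⟹ TA3b's `hAper` for EVERY coarse period),
**`sortM_arr : sortM n (arr (n*p) V) = arr p (sortM n V)`**, `sortK_arr`; §4 [folklore] `sortM_comp` ∕ `sortM_comp′` (TA1's `sortK_comp` ∕
`sortK_comp′` through `toF`; right factor's multiplier ROWS ∕ left factor's multiplier COLUMNS vanish off `n•ℤ^D`); §5 [folklore]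
**`tr_sortM : tr (sortM n K) = tr K`** (field diagonal re-indexed by `blockEquiv` and split over the block, multiplier diagonal supported on the
coarse points — `Function.Injective.tsum_eq`); §6 [folklore] **`tadpole_sortM`, `bubble_sortM`, `hessKer_sortM_apply`, `hessKer_sortM`** for a spread
leg whose multiplier rows AND columns vanish off-lattice (the dressed pack: `coDressKBmAt_KInvStep_inr_row_off` ∕ `_inr_col_off` at use) and
localised vertices (no hypothesis on their multiplier legs); §7 [folklore] **`hessT_reindex`** (TA4's `(ν ⊕ μ)`-index ↔ TA1's `Site × fibre-sum`
index); §8 [folklore] **THE TB5 SOCKET `tendsto_hessT_sortK_hessKer`**: for a decaying block-covariant pack `A` with off-lattice-vanishing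
multiplier legs, base-point vertices bi-localised at fine points, coarse periods `p_k → ∞`:
`hessT (periodiseF (p k) (sortK n A))^ (periodiseF (p k) (sortK n (arr (n·p k) (𝒱 μ 0))))^ (…)^ (…)^ → hessKer A 𝒱 𝒲 μ ν z`.
NOT HERE (honest): `M_T`∕`N_T` and their letters (TB1∕TB2), the ghost sides (TB3), jets = tables (TB4), the assembly (TB5); any estimate of a
Bałaban object beyond the transported constants.  The block side `n` is FIXED in every use; the `n`-dependence of the §3 constants is harmless.
Provenance: G-an2-4 formalisation swarm leaf seat `b2b-balaban-gan24-formalise-leaf-03` gen 44 (cross-lane; author of TA3b∕TA4), 2026-08-20.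
-/

noncomputable section

namespace Summit.QuantumFields.BalabanUV.Beta.D1BFx.SortedTraces

open Filter Topology
open scoped BigOperators
open Literature.Probability.LatticeModels (TorusSite Torus.proj)
open Literature.MathematicalPhysics.QuantumFieldTheory.LatticeForm (repZ quo)
open Literature.MathematicalPhysics.QuantumFieldTheory.Balaban1983to89
open Literature.MathematicalPhysics.QuantumFieldTheory.Balaban1983to89.Beta
open Literature.MathematicalPhysics.QuantumFieldTheory.Balaban1983to89.Beta.BlochFibreMatrix (repZ_nonneg repZ_lt)
open B12Sec2to5 (l1 l1_nonneg)
open ExpKernelCalculus (MKer Decays BiLoc comp tr bubble tadpole hessKer shiftK summable_exp_shift')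
open Summit.QuantumFields.BalabanUV.Beta.TameKernelCalculus (Spr Loc Tame slice_tame)
open Summit.QuantumFields.BalabanUV.Beta.D1BFx.FibredPeriodisation (periodiseF tsum_prod_fintype_right)
open Summit.QuantumFields.BalabanUV.Beta.D1BFx.SortedReblocking (finePt finePt_apply blockEquiv finePt_left_injective finePt_quo_proj
  finePt_imageShift imageShift_mul_eq_add)
open Summit.QuantumFields.BalabanUV.Beta.D1BFx.SortedPack (ι sortK sortK_comp sortK_comp')
open Summit.QuantumFields.BalabanUV.Beta.D1BFx.PeriodicArrays (arr toF arr_apply)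
open Summit.QuantumFields.BalabanUV.Beta.D1BFx.MixedVarPackedHess (hessT)
open Summit.QuantumFields.BalabanUV.Beta.D1BFx.TorusTraceTadpole (toF_comp tendsto_hessT_hessKer)

variable {D : ℕ} {F : Type*} {n : ℕ}

/-! ## §1 The sorted pack as an `ExpKernelCalculus` kernel over the coarse base -/

/-- [our object] **THE SORTED PACK AS A MATRIX-FIBRED KERNEL OVER THE COARSE LATTICE**: `sortM n K y y′ i j := sortK n K (y, i) (y′, j)`
— TA1's sorted form of an embedded pack `K : MKer D (F ⊕ F)` (fibre `((ℤ∕n)^D × F) ⊕ F`: fine bonds by in-block position, coarse bonds at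
in-block position `0`), read in the argument order of an2's `ExpKernelCalculus.MKer` so that `comp`, `tr`, `tadpole`, `bubble`, `hessKer`,
`Decays`, `BiLoc`, `arr` apply to it verbatim. -/
def sortM (n : ℕ) (K : MKer D (F ⊕ F)) : MKer D ((TorusSite D n × F) ⊕ F) := fun y y' i j => sortK n K (y, i) (y', j)

/-- [our object] Unfolding of `sortM`: the entry of `K` at the fine points `finePt n y (ι i).1`, `finePt n y′ (ι j).1` and the packed fibres
`(ι i).2`, `(ι j).2`. -/
theorem sortM_apply (K : MKer D (F ⊕ F)) (y y' : Fin D → ℤ) (i j : (TorusSite D n × F) ⊕ F) :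
    sortM n K y y' i j = K (finePt n y (ι i).1) (finePt n y' (ι j).1) (ι i).2 (ι j).2 := rfl

/-- [our object] **`toF (sortM n K) = sortK n K`**: the `FKer` reading (TA2's `toF`) of the sorted kernel IS TA1's sorted pack, so
`periodiseF p (sortK n K)` — the torus block matrices of TB1∕TB2 — is `periodiseF p (toF (sortM n K))`, TA3b's input form. -/
theorem toF_sortM (K : MKer D (F ⊕ F)) : toF (sortM n K) = sortK n K := rfl

/-- [folklore] `toF` is injective. -/
theorem toF_injective {G : Type*} {A B : MKer D G} (h : toF A = toF B) : A = B := by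
  funext x y a b
  exact congrFun (congrFun h (x, a)) (y, b)

/-! ## §2 Geometry of re-blocking: fine distances dominate coarse distances up to `D·n` -/

/-- [folklore] Box representatives differ by less than the block side: `|repZ z i − repZ z′ i| ≤ n`. -/
theorem abs_repZ_sub_repZ_le [NeZero n] (z z' : TorusSite D n) (i : Fin D) : |((repZ z i : ℤ) : ℝ) - ((repZ z' i : ℤ) : ℝ)| ≤ n := by
  have h0 := repZ_nonneg z i
  have h1 := repZ_lt z i
  have h0' := repZ_nonneg z' i
  have h1' := repZ_lt z' i
  rw [abs_sub_le_iff]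
  constructor <;> · linarith [(by exact_mod_cast h0 : (0:ℝ) ≤ repZ z i), (by exact_mod_cast h1 : (repZ z i : ℝ) < n),
      (by exact_mod_cast h0' : (0:ℝ) ≤ repZ z' i), (by exact_mod_cast h1' : (repZ z' i : ℝ) < n)]

/-- [folklore] **FINE DISTANCE ≥ COARSE DISTANCE − D·n**: `l1 (y − y′) − D·n ≤ l1 (finePt n y z − finePt n y′ z′)` (block side `n ≥ 1`). -/
theorem l1_finePt_sub_ge [NeZero n] (y y' : Fin D → ℤ) (z z' : TorusSite D n) :
    l1 (y - y') - D * n ≤ l1 (finePt n y z - finePt n y' z') := by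
  unfold l1
  have hn : (1 : ℝ) ≤ n := by exact_mod_cast NeZero.one_le
  have key : ∀ i : Fin D, |((y - y') i : ℝ)| - n ≤ |((finePt n y z - finePt n y' z') i : ℝ)| := by
    intro i
    have hr := abs_repZ_sub_repZ_le z z' i
    simp only [Pi.sub_apply, finePt_apply, Int.cast_sub, Int.cast_add, Int.cast_mul, Int.cast_natCast]
    set r : ℝ := ((repZ z i : ℤ) : ℝ) - ((repZ z' i : ℤ) : ℝ) with hr_def
    set w : ℝ := (y i : ℝ) - (y' i : ℝ) with hw
    have e : ((repZ z i : ℤ) : ℝ) + (n : ℝ) * (y i : ℝ) - (((repZ z' i : ℤ) : ℝ) + (n : ℝ) * (y' i : ℝ)) = r + n * w := by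
      rw [hr_def, hw]; ring
    rw [e]
    have h1 : (n : ℝ) * |w| - |r| ≤ |r + n * w| := by
      have := abs_sub (r + n * w) r
      rw [show r + n * w - r = n * w by ring, abs_mul, Nat.abs_cast] at this
      linarith
    have h2 : |w| ≤ (n : ℝ) * |w| := le_mul_of_one_le_left (abs_nonneg w) hn
    linarith
  have hs := Finset.sum_le_sum fun i (_ : i ∈ Finset.univ) => key i
  simp only [Finset.sum_sub_distrib, Finset.sum_const, Finset.card_univ, Fintype.card_fin, nsmul_eq_mul] at hs
  exact hs

/-- [folklore] The exponential form: `e^{−δ|finePt y z − finePt y′ z′|₁} ≤ e^{δ·D·n} · e^{−δ|y − y′|₁}` for `δ ≥ 0`. -/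
theorem exp_finePt_le [NeZero n] {δ : ℝ} (hδ : 0 ≤ δ) (y y' : Fin D → ℤ) (z z' : TorusSite D n) :
    Real.exp (-δ * l1 (finePt n y z - finePt n y' z')) ≤ Real.exp (δ * (D * n)) * Real.exp (-δ * l1 (y - y')) := by
  rw [← Real.exp_add]
  apply Real.exp_le_exp.mpr
  have := mul_le_mul_of_nonneg_left (l1_finePt_sub_ge (n := n) y y' z z') hδ
  nlinarith

/-! ## §3 Transport of the analytic hypotheses: `Decays`, `BiLoc`, block covariance, arrays -/

/-- [folklore] **`Decays` TRANSPORTS**: a fine kernel decaying at rate `δ ≥ 0` sorts to a coarse-base kernel decaying at the same rate, the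
constant picking up the block factor `e^{δ·D·n}` (the block side `n` is FIXED in every use, so an `n`-dependent constant is harmless). -/
theorem decays_sortM [NeZero n] {K : MKer D (F ⊕ F)} {C δ : ℝ} (hK : Decays K C δ) (hδ : 0 ≤ δ) :
    Decays (sortM n K) (C * Real.exp (δ * (D * n))) δ := by
  intro y y' i j
  rw [sortM_apply]
  have hC : 0 ≤ C := hK.nonneg (ι i).2
  refine (hK _ _ _ _).trans ?_
  rw [mul_assoc]
  exact mul_le_mul_of_nonneg_left (exp_finePt_le hδ _ _ _ _) hC

/-- [folklore] **`BiLoc` TRANSPORTS**: a fine kernel bi-localised at `(P, Q)` sorts to a coarse-base kernel bi-localised at the blocks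
`(quo n P, quo n Q)` of `P`, `Q`, same rate, constant `C·e^{2δ·D·n}`. -/
theorem biLoc_sortM [NeZero n] {K : MKer D (F ⊕ F)} {P Q : Fin D → ℤ} {C δ : ℝ} (hK : BiLoc K P Q C δ) (hδ : 0 ≤ δ) :
    BiLoc (sortM n K) (quo n P) (quo n Q) (C * Real.exp (δ * (2 * (D * n)))) δ := by
  intro y y' i j
  rw [sortM_apply]
  have hC : 0 ≤ C := hK.nonneg (ι i).2
  refine (hK _ _ _ _).trans ?_
  have hP := l1_finePt_sub_ge (n := n) y (quo n P) (ι i).1 (Torus.proj n P)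
  have hQ := l1_finePt_sub_ge (n := n) y' (quo n Q) (ι j).1 (Torus.proj n Q)
  rw [finePt_quo_proj] at hP hQ
  rw [mul_assoc, ← Real.exp_add]
  refine mul_le_mul_of_nonneg_left (Real.exp_le_exp.mpr ?_) hC
  have h1 := mul_le_mul_of_nonneg_left hP hδ
  have h2 := mul_le_mul_of_nonneg_left hQ hδ
  nlinarith

/-- [folklore] **BLOCK COVARIANCE ⟹ JOINT PERIODICITY FOR EVERY COARSE PERIOD**: if `shiftK (n • t) K = K` for all `t`, the sorted kernel is
invariant under the simultaneous image shifts of ANY period `p` on the coarse base — TA3b's hypothesis `hAper` along any sequence of tori. -/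
theorem sortM_imageShift {K : MKer D (F ⊕ F)} (hK : ∀ t : Fin D → ℤ, shiftK ((n : ℤ) • t) K = K) (p : ℕ) (y y' t : Fin D → ℤ)
    (i j : (TorusSite D n × F) ⊕ F) : sortM n K (imageShift p y t) (imageShift p y' t) i j = sortM n K y y' i j := by
  rw [sortM_apply, sortM_apply, finePt_imageShift, finePt_imageShift, imageShift_mul_eq_add, imageShift_mul_eq_add]
  have e := hK ((p : ℤ) • t)
  exact congrFun (congrFun (congrFun (congrFun e _) _) _) _

/-- [folklore] **ARRAYS SORT TO ARRAYS**: the periodic array of fine period `n·p` of a fine kernel sorts to the periodic array of coarse period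
`p` of the sorted kernel — `sortM n (arr (n*p) V) = arr p (sortM n V)` (termwise: `finePt n (y + p·t) z = finePt n y z + (n·p)·t`). -/
theorem sortM_arr (p : ℕ) (V : MKer D (F ⊕ F)) : sortM n (arr (n * p) V) = arr p (sortM n V) := by
  funext y y' i j
  simp only [sortM_apply, arr_apply, finePt_imageShift]

/-- [folklore] The sorted form of a fine array, in TA1's `sortK` currency: `sortK n (arr (n*p) V) = toF (arr p (sortM n V))`. -/
theorem sortK_arr (p : ℕ) (V : MKer D (F ⊕ F)) : sortK n (arr (n * p) V) = toF (arr p (sortM n V)) := by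
  rw [← toF_sortM, sortM_arr]

/-! ## §4 Composition: `sortM (A ∘ K) = sortM A ∘ sortM K` (the off-lattice multiplier entries vanish) -/

section Comp
variable [NeZero n] [Fintype F]

omit [Fintype F] in
/-- [folklore] The middle slices of `comp (sortM n A) (sortM n K)` are sub-series of the fine middle slices, hence summable for tame factors
(binder order as in `TorusTraceTadpole.toF_comp`). -/
theorem summable_slice_sortM {A K : MKer D (F ⊕ F)} (hA : Tame A) (hK : Tame K) (x z : Fin D → ℤ)
    (a b f : (TorusSite D n × F) ⊕ F) : Summable fun y => sortM n A x y a f * sortM n K y z f b := by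
  simp only [sortM_apply]
  exact (slice_tame hA hK (finePt n x (ι a).1) (finePt n z (ι b).1) (ι a).2 (ι f).2 (ι b).2).comp_injective
    (finePt_left_injective (ι f).1)

/-- [folklore] **SORTING IS MULTIPLICATIVE** (right form): `sortM n (comp A K) = comp (sortM n A) (sortM n K)` for tame `A`, `K` when the
multiplier ROWS of the right factor `K` vanish off the coarse sublattice `n•ℤ^D` (TA1's `sortK_comp` read through `toF`, TA3b's `toF_comp`). -/
theorem sortM_comp {A K : MKer D (F ⊕ F)} (hA : Tame A) (hK : Tame K)
    (hKo : ∀ y z f b, Torus.proj n y ≠ 0 → K y z (Sum.inr f) b = 0) : sortM n (comp A K) = comp (sortM n A) (sortM n K) := by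
  apply toF_injective
  rw [toF_sortM, sortK_comp hA hK hKo, ← toF_sortM, ← toF_sortM, toF_comp (summable_slice_sortM hA hK)]

/-- [folklore] **SORTING IS MULTIPLICATIVE** (left form): the same with the hypothesis on the multiplier COLUMNS of the left factor `A`. -/
theorem sortM_comp' {A K : MKer D (F ⊕ F)} (hA : Tame A) (hK : Tame K)
    (hAo : ∀ x y a f, Torus.proj n y ≠ 0 → A x y a (Sum.inr f) = 0) : sortM n (comp A K) = comp (sortM n A) (sortM n K) := by
  apply toF_injective
  rw [toF_sortM, sortK_comp' hA hK hAo, ← toF_sortM, ← toF_sortM, toF_comp (summable_slice_sortM hA hK)]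

omit [NeZero n] in
/-- [folklore] A composition inherits vanishing off-lattice multiplier ROWS from its left factor. -/
theorem comp_inr_row_off {A : MKer D (F ⊕ F)} (hAr : ∀ x y f b, Torus.proj n x ≠ 0 → A x y (Sum.inr f) b = 0) (K : MKer D (F ⊕ F))
    {x : Fin D → ℤ} (hx : Torus.proj n x ≠ 0) (z : Fin D → ℤ) (f : F) (b : F ⊕ F) : comp A K x z (Sum.inr f) b = 0 := by
  unfold ExpKernelCalculus.comp
  simp only [hAr x _ f _ hx, zero_mul, Finset.sum_const_zero, tsum_zero]

omit [NeZero n] in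
/-- [folklore] A composition inherits vanishing off-lattice multiplier COLUMNS from its right factor. -/
theorem comp_inr_col_off (A : MKer D (F ⊕ F)) {K : MKer D (F ⊕ F)} (hKc : ∀ x y a f, Torus.proj n y ≠ 0 → K x y a (Sum.inr f) = 0)
    (x : Fin D → ℤ) {z : Fin D → ℤ} (hz : Torus.proj n z ≠ 0) (a : F ⊕ F) (f : F) : comp A K x z a (Sum.inr f) = 0 := by
  unfold ExpKernelCalculus.comp
  simp only [hKc _ z _ f hz, mul_zero, Finset.sum_const_zero, tsum_zero]

end Comp

/-! ## §5 The trace: `tr (sortM n K) = tr K` -/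

section Trace
variable [NeZero n] [Fintype F]

/-- [folklore] A localised kernel has a summable diagonal, fibre by fibre. -/
theorem summable_diag_of_loc {G : Type*} {K : MKer D G} (hK : Loc K) (c c' : G) : Summable fun x : Fin D → ℤ => K x x c c' := by
  obtain ⟨p, q, C, δ, hδ, hB⟩ := hK
  have hC : 0 ≤ C := hB.nonneg c
  refine Summable.of_norm_bounded (g := fun x => C * Real.exp (-δ * l1 (x - p))) ((summable_exp_shift' hδ p).mul_left C) fun x => ?_
  rw [Real.norm_eq_abs]
  refine (hB x x c c').trans (mul_le_mul_of_nonneg_left (Real.exp_le_exp.mpr ?_) hC)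
  nlinarith [l1_nonneg (x - q)]

/-- [folklore] **THE TRACE IS INVARIANT UNDER SORTING**: `tr (sortM n K) = tr K` for a kernel with fibrewise-summable diagonal whose multiplier
DIAGONAL entries vanish off the coarse sublattice.  The field part of the fine diagonal sum is re-indexed by the re-blocking equivalence
`(y, z) ↦ finePt n y z` and split into the finite in-block sum; the multiplier part is supported on the coarse points `finePt n y 0 = n•y`
(`Function.Injective.tsum_eq`). -/
theorem tr_sortM {K : MKer D (F ⊕ F)} (hs : ∀ c : F ⊕ F, Summable fun x : Fin D → ℤ => K x x c c)
    (h0 : ∀ x f, Torus.proj n x ≠ 0 → K x x (Sum.inr f) (Sum.inr f) = 0) : tr (sortM n K) = tr K := by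
  -- the two parts of the fine diagonal
  set fF : (Fin D → ℤ) → ℝ := fun x => ∑ a : F, K x x (Sum.inl a) (Sum.inl a) with hfF
  set fM : (Fin D → ℤ) → ℝ := fun x => ∑ a : F, K x x (Sum.inr a) (Sum.inr a) with hfM
  have hsF : Summable fF := summable_sum fun a _ => hs (Sum.inl a)
  have hsM : Summable fM := summable_sum fun a _ => hs (Sum.inr a)
  have htrK : tr K = ∑' x, fF x + ∑' x, fM x := by
    unfold ExpKernelCalculus.tr
    rw [← hsF.tsum_add hsM]
    exact tsum_congr fun x => Fintype.sum_sum_type _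
  -- field part: re-index by blocks and split the in-block sum
  have habs : ∀ z : TorusSite D n, Summable fun y : Fin D → ℤ => |fF (finePt n y z)| := fun z =>
    hsF.abs.comp_injective (finePt_left_injective z)
  have hF : ∑' x, fF x = ∑' y, ∑ z : TorusSite D n, fF (finePt n y z) :=
    calc ∑' x, fF x = ∑' q : (Fin D → ℤ) × TorusSite D n, fF (finePt n q.1 q.2) := by
          rw [← (blockEquiv n).tsum_eq fF]; rfl
      _ = ∑ z : TorusSite D n, ∑' y, fF (finePt n y z) :=
          (tsum_prod_fintype_right (F := fun q : (Fin D → ℤ) × TorusSite D n => fF (finePt n q.1 q.2)) habs).2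
      _ = ∑' y, ∑ z : TorusSite D n, fF (finePt n y z) := (Summable.tsum_finsetSum fun z _ => (habs z).of_abs).symm
  -- multiplier part: supported on the coarse points
  have hM : ∑' x, fM x = ∑' y, fM (finePt n y 0) := by
    refine ((finePt_left_injective (n := n) (0 : TorusSite D n)).tsum_eq fun x hx => ?_).symm
    by_contra hx'
    apply hx
    refine Finset.sum_eq_zero fun a _ => h0 x a fun h => hx' ⟨quo n x, ?_⟩
    show finePt n (quo n x) 0 = x
    rw [← h]; exact finePt_quo_proj x
  -- the sorted diagonal
  have hsortF : ∀ y, ∑ i : TorusSite D n × F, sortM n K y y (Sum.inl i) (Sum.inl i) = ∑ z : TorusSite D n, fF (finePt n y z) := by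
    intro y; rw [Fintype.sum_prod_type]; rfl
  have hsortM : ∀ y, ∑ a : F, sortM n K y y (Sum.inr a) (Sum.inr a) = fM (finePt n y 0) := fun y => rfl
  have hs1 : Summable fun y : Fin D → ℤ => ∑ z : TorusSite D n, fF (finePt n y z) :=
    summable_sum fun z _ => hsF.comp_injective (finePt_left_injective z)
  have hs2 : Summable fun y : Fin D → ℤ => fM (finePt n y 0) := hsM.comp_injective (finePt_left_injective 0)
  unfold ExpKernelCalculus.tr at htrK ⊢
  rw [htrK, hF, hM, ← hs1.tsum_add hs2]
  refine tsum_congr fun y => ?_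
  rw [Fintype.sum_sum_type, hsortF, hsortM]

end Trace

/-! ## §6 The one-loop functionals are invariant under sorting -/

section Functionals
variable [NeZero n] [Fintype F]

/-- [folklore] **THE TADPOLE IS INVARIANT UNDER SORTING**: `tadpole (sortM n A) (sortM n W) = tadpole A W` for a spread leg `A` whose multiplier
rows and columns vanish off the coarse sublattice and a localised vertex `W` (no hypothesis on the vertex's multiplier legs). -/
theorem tadpole_sortM {A W : MKer D (F ⊕ F)} (hA : Spr A) (hW : Loc W)
    (hAr : ∀ x y f b, Torus.proj n x ≠ 0 → A x y (Sum.inr f) b = 0) (hAc : ∀ x y a f, Torus.proj n y ≠ 0 → A x y a (Sum.inr f) = 0) :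
    tadpole (sortM n A) (sortM n W) = tadpole A W := by
  unfold ExpKernelCalculus.tadpole
  rw [← sortM_comp' hA.tame hW.tame hAc]
  exact tr_sortM (fun c => summable_diag_of_loc (hA.comp_loc hW) c c) fun x f hx => comp_inr_row_off hAr W hx x f (Sum.inr f)

/-- [folklore] **THE BUBBLE IS INVARIANT UNDER SORTING**: `bubble (sortM n A) (sortM n V) (sortM n V′) = bubble A V V′` (same hypotheses on the leg;
localised vertices `V`, `V′`). -/
theorem bubble_sortM {A V V' : MKer D (F ⊕ F)} (hA : Spr A) (hV : Loc V) (hV' : Loc V')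
    (hAr : ∀ x y f b, Torus.proj n x ≠ 0 → A x y (Sum.inr f) b = 0) (hAc : ∀ x y a f, Torus.proj n y ≠ 0 → A x y a (Sum.inr f) = 0) :
    bubble (sortM n A) (sortM n V) (sortM n V') = bubble A V V' := by
  unfold ExpKernelCalculus.bubble
  have hAV : Loc (comp A V) := hA.comp_loc hV
  have hAV' : Loc (comp A V') := hA.comp_loc hV'
  rw [← sortM_comp' hA.tame hV.tame hAc, ← sortM_comp' hA.tame hV'.tame hAc,
    ← sortM_comp hAV.tame hAV'.tame fun y z f b hy => comp_inr_row_off hAr V' hy z f b]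
  exact tr_sortM (fun c => summable_diag_of_loc (hAV.comp hAV') c c) fun x f hx =>
    comp_inr_row_off (fun x' y' f' b' hx' => comp_inr_row_off hAr V hx' y' f' b') (comp A V') hx x f (Sum.inr f)

/-- [folklore] **THE RESOLVENT HESSIAN KERNEL IS INVARIANT UNDER SORTING**, entry by entry: for the base-point families `𝒱`, `𝒲` of
`ExpKernelCalculus.hessKer` with `𝒱 μ 0`, `𝒱 ν z`, `𝒲 μ 0 ν z` localised,
`hessKer (sortM n A) (sortM ∘ 𝒱) (sortM ∘ 𝒲) μ ν z = hessKer A 𝒱 𝒲 μ ν z`. -/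
theorem hessKer_sortM_apply {A : MKer D (F ⊕ F)} (hA : Spr A)
    (hAr : ∀ x y f b, Torus.proj n x ≠ 0 → A x y (Sum.inr f) b = 0) (hAc : ∀ x y a f, Torus.proj n y ≠ 0 → A x y a (Sum.inr f) = 0)
    (𝒱 : Fin D → (Fin D → ℤ) → MKer D (F ⊕ F)) (𝒲 : Fin D → (Fin D → ℤ) → Fin D → (Fin D → ℤ) → MKer D (F ⊕ F))
    {μ ν : Fin D} {z : Fin D → ℤ} (hV : Loc (𝒱 μ 0)) (hV' : Loc (𝒱 ν z)) (hW : Loc (𝒲 μ 0 ν z)) :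
    hessKer (sortM n A) (fun μ z => sortM n (𝒱 μ z)) (fun μ z ν w => sortM n (𝒲 μ z ν w)) μ ν z = hessKer A 𝒱 𝒲 μ ν z := by
  simp only [ExpKernelCalculus.hessKer]
  rw [tadpole_sortM hA hW hAr hAc, bubble_sortM hA hV hV' hAr hAc]

/-- [folklore] The same for the whole kernel, when every member of the two families is localised. -/
theorem hessKer_sortM {A : MKer D (F ⊕ F)} (hA : Spr A)
    (hAr : ∀ x y f b, Torus.proj n x ≠ 0 → A x y (Sum.inr f) b = 0) (hAc : ∀ x y a f, Torus.proj n y ≠ 0 → A x y a (Sum.inr f) = 0)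
    {𝒱 : Fin D → (Fin D → ℤ) → MKer D (F ⊕ F)} {𝒲 : Fin D → (Fin D → ℤ) → Fin D → (Fin D → ℤ) → MKer D (F ⊕ F)}
    (hV : ∀ μ z, Loc (𝒱 μ z)) (hW : ∀ μ z ν w, Loc (𝒲 μ z ν w)) :
    hessKer (sortM n A) (fun μ z => sortM n (𝒱 μ z)) (fun μ z ν w => sortM n (𝒲 μ z ν w)) = hessKer A 𝒱 𝒲 := by
  funext μ ν z
  exact hessKer_sortM_apply hA hAr hAc 𝒱 𝒲 (hV μ 0) (hV ν z) (hW μ 0 ν z)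

end Functionals

/-! ## §7 `hessT` under re-indexing (TA4's `(ν ⊕ μ)`-blocks ↔ TA1's `Site × (fibre sum)`) -/

section Reindex
variable {κ κ' : Type*} [Fintype κ] [Fintype κ']

/-- [folklore] The trace is invariant under a simultaneous re-indexing of rows and columns by an equivalence. -/
theorem trace_submatrix_equiv (e : κ' ≃ κ) (M : Matrix κ κ ℝ) : (M.submatrix e e).trace = M.trace := by
  simp only [Matrix.trace, Matrix.diag, Matrix.submatrix_apply]
  exact e.sum_comp (fun i => M i i)

/-- [folklore] **`hessT` IS INVARIANT UNDER RE-INDEXING**: `hessT (reindex e e L) (reindex e e V) (reindex e e V′) (reindex e e W) = hessT L V V′ W`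
— the bridge from TA4's `hessT` over `ν_T ⊕ μ_T` (`mixedVar_kkt_fromRows_zero`) to TA1's single-sorted index `Site D p × (((ℤ∕n)^D × F) ⊕ F)`
(`SortedKernels.reindex_periodiseF_fpack`, `blocksHat_eq_reindex`). -/
theorem hessT_reindex (e : κ ≃ κ') (L V V' W : Matrix κ κ ℝ) :
    hessT (Matrix.reindex e e L) (Matrix.reindex e e V) (Matrix.reindex e e V') (Matrix.reindex e e W) = hessT L V V' W := by
  unfold hessT
  simp only [Matrix.reindex_apply, Matrix.submatrix_mul_equiv, trace_submatrix_equiv]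

end Reindex

/-! ## §8 THE TB5 SOCKET: the torus one-loop functional in TB1∕TB2's sorted currency converges to the road's `hessKer` -/

section Socket
variable [NeZero n] [Fintype F]

/-- [folklore] **THE SORTED HESS LIMIT (TA3b IN TB1∕TB2's CURRENCY)**.  Data: an embedded pack `A : MKer D (F ⊕ F)` on the FINE lattice,
decaying (`Decays A CA δA`, `δA > 0`), covariant under the block translations (`shiftK (n • t) A = A`), with multiplier rows and columns
vanishing off the coarse sublattice `n•ℤ^D` (on the road: the dressed pack, `coDressKBmAt_KInvStep_inr_row_off` ∕ `_inr_col_off`); base-point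
vertex families `𝒱`, `𝒲` with `𝒱 μ 0`, `𝒱 ν z`, `𝒲 μ 0 ν z` bi-localised at fine points at a common rate `δ > 0`; coarse periods `p_k → ∞`.
Conclusion: the torus functional `hessT` of the SORTED periodised leg `(periodiseF (p k) (sortK n A))^` against the SORTED periodised fine
arrays `(periodiseF (p k) (sortK n (arr (n·p k) ·)))^` of the three vertices — the objects TB1∕TB2∕TA4 produce over the coarse torus
`Site D (p k)` with fibre `((ℤ∕n)^D × F) ⊕ F` — converges to `hessKer A 𝒱 𝒲 μ ν z` IN THE ROAD'S FINE-LATTICE CURRENCY.  Proof: `sortK = toF ∘ sortM`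
(§1), `sortK n (arr (n·p) V) = toF (arr p (sortM n V))` (§3), TA3b's `tendsto_hessT_hessKer` over the coarse base at the sorted data (hypotheses
by §3), and `hessKer_sortM_apply` (§6). -/
theorem tendsto_hessT_sortK_hessKer {A : MKer D (F ⊕ F)} {CA δA : ℝ} (hA : Decays A CA δA) (hδA : 0 < δA)
    (hAcov : ∀ t : Fin D → ℤ, shiftK ((n : ℤ) • t) A = A)
    (hAr : ∀ x y f b, Torus.proj n x ≠ 0 → A x y (Sum.inr f) b = 0) (hAc : ∀ x y a f, Torus.proj n y ≠ 0 → A x y a (Sum.inr f) = 0)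
    (𝒱 : Fin D → (Fin D → ℤ) → MKer D (F ⊕ F)) (𝒲 : Fin D → (Fin D → ℤ) → Fin D → (Fin D → ℤ) → MKer D (F ⊕ F))
    (μ ν : Fin D) (z : Fin D → ℤ) {P P' Q Q' : Fin D → ℤ} {Cv Cv' C δ : ℝ}
    (hV : BiLoc (𝒱 μ 0) P P' Cv δ) (hV' : BiLoc (𝒱 ν z) Q' Q Cv' δ) (hW : BiLoc (𝒲 μ 0 ν z) P Q C δ) (hδ : 0 < δ)
    {p : ℕ → ℕ} [∀ k, NeZero (p k)] (hp : Tendsto p atTop atTop) :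
    Tendsto (fun k => hessT (Matrix.of (periodiseF (p k) (sortK n A)))
        (Matrix.of (periodiseF (p k) (sortK n (arr (n * p k) (𝒱 μ 0)))))
        (Matrix.of (periodiseF (p k) (sortK n (arr (n * p k) (𝒱 ν z)))))
        (Matrix.of (periodiseF (p k) (sortK n (arr (n * p k) (𝒲 μ 0 ν z))))))
      atTop (𝓝 (hessKer A 𝒱 𝒲 μ ν z)) := by
  have hA' := decays_sortM (n := n) hA hδA.le
  have hAper : ∀ k, ∀ x y t, ∀ a b : (TorusSite D n × F) ⊕ F,
      sortM n A (imageShift (p k) x t) (imageShift (p k) y t) a b = sortM n A x y a b :=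
    fun k x y t a b => sortM_imageShift hAcov (p k) x y t a b
  have h := tendsto_hessT_hessKer hA' hδA hAper (fun μ z => sortM n (𝒱 μ z)) (fun μ z ν w => sortM n (𝒲 μ z ν w)) μ ν z
    (biLoc_sortM hV hδ.le) (biLoc_sortM hV' hδ.le) (biLoc_sortM hW hδ.le) hδ hp
  rw [hessKer_sortM_apply ⟨_, _, hδA, hA⟩ hAr hAc 𝒱 𝒲 ⟨_, _, _, _, hδ, hV⟩ ⟨_, _, _, _, hδ, hV'⟩ ⟨_, _, _, _, hδ, hW⟩] at h
  simp only [← toF_sortM, sortM_arr]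
  exact h

end Socket

end Summit.QuantumFields.BalabanUV.Beta.D1BFx.SortedTraces

end
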